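import Mathlib.Data.Finsupp.Lex
import Mathlib.Data.Finsupp.Weight
import Mathlib.Data.Fintype.BigOperators
import Mathlib.Algebra.BigOperators.Ring.Finset
import Mathlib.Tactic
import HarnessLib

/-!
# The lowest-order coefficients of a diagonal pullback `G = (⊗_s h_s) · Φ^* F` (CDT eq. (6.16))

Calegari–Dimitrov–Tang, arXiv:2408.15403, §6.4 eq. (6.16) (p. 51): for the diagonal holomorphic
map `Φ(𝐳) = (Φ_1(z_1),…,Φ_d(z_d))`, `Φ_s(0) = 0`, and `G(𝐳) = h(z_1)⋯h(z_d)·F(Φ(𝐳))` with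
`h(0) = 1`, "by construction, the `𝐳^𝐧` coefficient of `G(𝐳)` equals
`β · exp(Σ_k (Σ'_j n_j) log φ_k'(0))`" for a minimal-order monomial `β 𝐱^𝐧` of `F`. The
mechanism is coefficient bookkeeping: the `𝐳^𝛎` coefficient of `G` is
`a_𝛎 = Σ_{𝛍 ≤ 𝛎} β_𝛍 Π_s t_s(μ_s, ν_s)` where `t_s(μ, r) = [z^r](Φ_s(z)^μ h_s(z))` vanishes for
`r < μ` and equals `Φ_s'(0)^μ` for `r = μ`. This file proves, from these two properties of `t`
alone: (1) `a_𝛎 ≠ 0 ⟹ |𝛎| ≥ β₀` (the minimal degree of `F`), (2) for `|𝛎| = β₀`,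
`a_𝛎 = β_𝛎 Π_s Φ_s'(0)^{ν_s}` (eq. (6.16)), hence (3) the lexicographically highest minimal exponent
of `F` is also that of `G` — the hypotheses of the dampener trick
`CalegariDimitrovTang.coeff_vprod_pow_mul`.

No named facts.

## References

* [CalegariDimitrovTang2024] arXiv:2408.15403, §6.4 eq. (6.16) (p. 51); §6.5.3 eq. (6.21).
-/

noncomputable section

open Finset

namespace Literature.NumberTheory.Transcendental

namespace CalegariDimitrovTang

variable {d : ℕ} {R : Type*} [CommRing R]

/-- The coefficients of the pullback: `a_𝛎 = Σ_{𝛍 ≤ 𝛎} β_𝛍 Π_s t_s(μ_s, ν_s)` (sum over the box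
`𝛍 ≤ 𝛎`, encoded as `μ_s ∈ {0,…,ν_s}`). [cite: CalegariDimitrovTang2024, §6.4 eq. (6.16)] -/
def pullCoeff (β : (Fin d → ℕ) → R) (t : Fin d → ℕ → ℕ → R) (ν : Fin d → ℕ) : R :=
  ∑ μ ∈ Fintype.piFinset fun s => Finset.range (ν s + 1), β μ * ∏ s, t s (μ s) (ν s)

/-- The standing properties of the one-variable transfer coefficients
`t_s(μ, r) = [z^r](Φ_s^μ h_s)`: zero below the diagonal, `λ_s^μ` on it.
[cite: CalegariDimitrovTang2024, §6.4 (Φ_s(0) = 0, h(0) = 1)] -/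
structure TransferData (t : Fin d → ℕ → ℕ → R) (lam : Fin d → R) : Prop where
  below : ∀ s μ r, r < μ → t s μ r = 0
  diag : ∀ s μ, t s μ μ = lam s ^ μ

variable {β : (Fin d → ℕ) → R} {t : Fin d → ℕ → ℕ → R} {lam : Fin d → R}

/-- A non-zero `a_𝛎` has a non-zero term: some `𝛍 ≤ 𝛎` with `β_𝛍 ≠ 0` and all `t_s(μ_s, ν_s) ≠ 0`.
[folklore] -/
theorem exists_of_pullCoeff_ne_zero {ν : Fin d → ℕ} (hν : pullCoeff β t ν ≠ 0) :
    ∃ μ : Fin d → ℕ, (∀ s, μ s ≤ ν s) ∧ β μ ≠ 0 ∧ ∀ s, t s (μ s) (ν s) ≠ 0 := by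
  obtain ⟨μ, hμ, hne⟩ := Finset.exists_ne_zero_of_sum_ne_zero hν
  rw [Fintype.mem_piFinset] at hμ
  refine ⟨μ, fun s => Nat.lt_succ_iff.mp (Finset.mem_range.mp (hμ s)), fun h => hne (by rw [h, zero_mul]),
    fun s h => hne ?_⟩
  rw [Finset.prod_eq_zero (Finset.mem_univ s) h, mul_zero]

/-- **(1) Degrees do not drop**: if all `β_𝛍` with `|𝛍| < β₀` vanish, then so do all `a_𝛎` with
`|𝛎| < β₀`. [cite: CalegariDimitrovTang2024, §6.4 (minimality of `|𝐧|` is preserved)] -/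
theorem pullCoeff_eq_zero_of_degree_lt {β₀ : ℕ}
    (hβ : ∀ μ : Fin d → ℕ, ∑ s, μ s < β₀ → β μ = 0) {ν : Fin d → ℕ} (hν : ∑ s, ν s < β₀) :
    pullCoeff β t ν = 0 := by
  by_contra h
  obtain ⟨μ, hle, hβμ, -⟩ := exists_of_pullCoeff_ne_zero h
  exact hβμ (hβ μ (lt_of_le_of_lt (Finset.sum_le_sum fun s _ => hle s) hν))

/-- **(2) Eq. (6.16)**: on the minimal degree, `a_𝛎 = β_𝛎 · Π_s λ_s^{ν_s}`.
[cite: CalegariDimitrovTang2024, §6.4 eq. (6.16) (p. 51)] -/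
theorem pullCoeff_eq_of_degree_eq (ht : TransferData t lam) {β₀ : ℕ}
    (hβ : ∀ μ : Fin d → ℕ, ∑ s, μ s < β₀ → β μ = 0) {ν : Fin d → ℕ} (hν : ∑ s, ν s = β₀) :
    pullCoeff β t ν = β ν * ∏ s, lam s ^ ν s := by
  unfold pullCoeff
  rw [Finset.sum_eq_single ν]
  · congr 1
    exact Finset.prod_congr rfl fun s _ => ht.diag s (ν s)
  · intro μ hμ hμν
    rw [Fintype.mem_piFinset] at hμ
    have hle : ∀ s, μ s ≤ ν s := fun s => Nat.lt_succ_iff.mp (Finset.mem_range.mp (hμ s))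
    -- either `|μ| < β₀` (then `β_μ = 0`) or `μ = ν`
    by_cases hsum : ∑ s, μ s < β₀
    · rw [hβ μ hsum, zero_mul]
    · exfalso
      apply hμν
      have heq : ∑ s, μ s = ∑ s, ν s := by
        have := Finset.sum_le_sum fun s (_ : s ∈ Finset.univ) => hle s
        omega
      funext s
      exact ((Finset.sum_eq_sum_iff_of_le fun s _ => hle s).mp heq s (Finset.mem_univ s))
  · intro h
    exfalso
    exact h (Fintype.mem_piFinset.mpr fun s => Finset.mem_range.mpr (Nat.lt_succ_self _))

/-- **(3) The minimal-degree support is preserved up to the unit factors `Π λ_s^{ν_s}`**: with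
`λ_s` non-zero-divisors (e.g. `Φ_s'(0) ≠ 0` in a field), `a_𝛎 ≠ 0 ↔ β_𝛎 ≠ 0` on `|𝛎| = β₀`; in
particular the lexicographically highest minimal exponent of `F` is that of `G`.
[cite: CalegariDimitrovTang2024, §6.4–6.5.3] -/
theorem pullCoeff_ne_zero_iff [IsDomain R] (ht : TransferData t lam) (hlam : ∀ s, lam s ≠ 0) {β₀ : ℕ}
    (hβ : ∀ μ : Fin d → ℕ, ∑ s, μ s < β₀ → β μ = 0) {ν : Fin d → ℕ} (hν : ∑ s, ν s = β₀) :
    pullCoeff β t ν ≠ 0 ↔ β ν ≠ 0 := by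
  rw [pullCoeff_eq_of_degree_eq ht hβ hν]
  have : ∏ s, lam s ^ ν s ≠ 0 := Finset.prod_ne_zero_iff.mpr fun s _ => pow_ne_zero _ (hlam s)
  constructor
  · intro h hb; exact h (by rw [hb, zero_mul])
  · intro h; exact mul_ne_zero h this

end CalegariDimitrovTang

end Literature.NumberTheory.Transcendental
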